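import Summits.PneNP.PneNP.Theorems.ConstantBand.Negative.LoadBearing
import Summits.PneNP.PneNP.Theorems.SliceACZero.Negative.DeltaBeforeK
import Literature.Computability.Complexity.RossmanMonotoneCliqueGraphs
import Literature.Computability.Complexity.CliqueThresholdBounds
import Literature.Computability.Complexity.RossmanMonotoneCliqueLemma23Proofs

/-!
# Route OneSlice, crux `ConstantBand` (stmt-PneNP-2834), line `flat-prior-relative-minterms`:
# slice Lemma 23 (S1) — counting toolkit

Helper file for the stub `stub_sliceLemma23` (the SLICE form of Rossman FOCS'10 Lemma 23: planted
`k`-clique versus uniform on one Erdős–Rényi slice, Cauchy–Schwarz form). Everything is finite counting on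
the Hamming slices `slice n i = {x : e(x) = i}` of the edge cube of `K_n` (vocabulary of
`Theorems/ConstantBand/Negative/LoadBearing.lean`):

* §1 `l23_card_slice_filter_supset_le_real`: the hypergeometric tail `#{x ∈ slice_i : F ⊆ x} ≤
  (i/C(n,2))^{|F|}·#slice_i` over `ℝ`, and `l23_card_slice_cast_pos`; the slice counts
  `#slice_i = C(C(n,2), i)` and `#{x ∈ slice_i : F ⊆ x} ≤ C(C(n,2)-|F|, i-|F|)` are the landed
  `sliceCard_eq` / `card_slice_supset_le` of `Theorems/SliceACZero/Negative/DeltaBeforeK.lean`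
  (`sliceCard n i = #(slice n i)` by `rfl`);
* §2 planting off the overlap event: `l23_edgeCount_plantClique` (`e(x ∪ K_A) = e(x) + C(|A|,2)` when
  `K_A ∩ x = ∅`), `l23_eq_of_plantClique_eq` (injectivity of `x ↦ x ∪ K_A` there), `l23_cliqueFn_plantClique`;
* §3 `l23_card_overlap_le`: the overlap pairs `{(x, A) : K_A ∩ x ≠ ∅}` are a `≤ C(k,2)·i/C(n,2)`
  fraction of `slice_i × ([n] choose k)`;
* §4 `l23_card_noOverlap_le`: the non-overlap planted pairs with `f(x ∪ K_A) = 0` fibre over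
  `y = x ∪ K_A ∈ slice_{i + C(k,2)}` (`f(y) = 0`, `CLIQUE_k(y) = 1`) with multiplicity `≤ ω_k(y)`;
* §5 `l23_choose_add_mul_pow_le`: `C(N, i+K)·(i+1)^K ≤ C(N, i)·N^K` (ratio of adjacent slice sizes);
* §6 `l23_eventually_regime`, `l23_window`, `l23_regime_slice`: the eventual regime in `n` (`n ≥ 2k`,
  `T^{3/4} ≤ T/4`, `T ≥ 4(w + C(k,2) + 1)`, `θ ≤ 1/2`, `2C(k,2)θ ≤ ε` with `θ = n^{-2/(k-1)}`, `T = C(n,2)θ`,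
  `thr k n = ⌊T⌋₊`) and what it gives on a central band slice `i`: `C(k,2) ≤ i`, `i + C(k,2) ≤ C(n,2)`,
  `(i + C(k,2))/C(n,2) ≤ 2θ`, `θ/2 ≤ i/C(n,2)`, `C(k,2)·i ≤ ε·C(n,2)`.

[folklore]
-/

noncomputable section

namespace Summit.PneNP.PneNP.Cruxes.ConstantBand.FlatPriorRelativeMinterms

open Literature.Computability.Complexity Filter Classical
open Finset hiding slice
open Summit.PneNP.PneNP.Theorems.ConstantBand.Negative

set_option linter.dupNamespace false

variable {n : ℕ}

/-! ## §1 Slice counting (on top of `Theorems/SliceACZero/Negative/DeltaBeforeK.lean`) -/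

/-- A slice `i ≤ C(n,2)` is non-empty (real-cast form). [folklore] -/
theorem l23_card_slice_cast_pos {i : ℕ} (hi : i ≤ n.choose 2) : (0 : ℝ) < #(slice n i) := by
  have h : #(slice n i) = (n.choose 2).choose i := Theorems.SliceACZero.Negative.sliceCard_eq n i
  rw [h]
  exact_mod_cast Nat.choose_pos hi

/-- **Hypergeometric tail over `ℝ`**: `#{x ∈ slice_i : F ⊆ x} ≤ (i / C(n,2))^{|F|} · #slice_i`
(`i ≤ C(n,2)`, `C(n,2) > 0`): the exact count `C(C(n,2) - |F|, i - |F|)` (`card_slice_supset_le`) and the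
binomial ratio `C(N-v, i-v)·N^v ≤ i^v·C(N, i)` (`choose_sub_mul_pow_le_pow_mul_choose`). [folklore] -/
theorem l23_card_slice_filter_supset_le_real (F : Finset (Edge n)) {i : ℕ} (hi : i ≤ n.choose 2)
    (hN : 0 < n.choose 2) :
    (#((slice n i).filter fun x => ∀ e ∈ F, x e = true) : ℝ) ≤
      ((i : ℝ) / n.choose 2) ^ #F * #(slice n i) := by
  have hnat : #((slice n i).filter fun x => ∀ e ∈ F, x e = true) * (n.choose 2) ^ #F ≤
      i ^ #F * #(slice n i) := by
    by_cases hF : #F ≤ i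
    · have h1 : #((slice n i).filter fun x => ∀ e ∈ F, x e = true) ≤ (n.choose 2 - #F).choose (i - #F) := by
        have h := Theorems.SliceACZero.Negative.card_slice_supset_le i F hF
        refine le_trans (le_of_eq ?_) h
        rw [slice, filter_filter]
      calc #((slice n i).filter fun x => ∀ e ∈ F, x e = true) * (n.choose 2) ^ #F
          ≤ (n.choose 2 - #F).choose (i - #F) * (n.choose 2) ^ #F := Nat.mul_le_mul_right _ h1
        _ ≤ i ^ #F * (n.choose 2).choose i := choose_sub_mul_pow_le_pow_mul_choose #F (n.choose 2) i hF hi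
        _ = i ^ #F * #(slice n i) := by
            have h : #(slice n i) = (n.choose 2).choose i := Theorems.SliceACZero.Negative.sliceCard_eq n i
            rw [h]
    · have h0 : (slice n i).filter (fun x => ∀ e ∈ F, x e = true) = ∅ := by
        refine filter_eq_empty_iff.2 fun x hx hall => hF ?_
        rw [slice, mem_filter] at hx
        rw [← hx.2, edgeCount]
        exact card_le_card fun e he => mem_filter.2 ⟨mem_univ _, hall e he⟩
      rw [h0, card_empty, zero_mul]
      exact Nat.zero_le _
  have hN' : (0 : ℝ) < (n.choose 2 : ℝ) ^ #F := by positivity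
  rw [div_pow, div_mul_eq_mul_div, le_div_iff₀ hN']
  exact_mod_cast hnat

/-! ## §2 Planting off the overlap event -/

/-- Planting `K_A` into a background avoiding `K_A` adds exactly `C(|A|,2)` edges. [folklore] -/
theorem l23_edgeCount_plantClique (A : Finset (Fin n)) {x : Edge n → Bool}
    (hx : ∀ e, cliqueVec A e = true → x e = false) :
    edgeCount (plantClique A x) = edgeCount x + (#A).choose 2 := by
  rw [edgeCount, edgeCount, ← card_filter_cliqueVec A, ← card_union_of_disjoint]
  · congr 1
    ext e
    simp only [mem_filter, mem_univ, true_and, mem_union, plantClique, Bool.or_eq_true]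
  · rw [disjoint_left]
    intro e he he'
    rw [mem_filter] at he he'
    have := hx e he'.2
    rw [he.2] at this
    exact Bool.noConfusion this

/-- Off the overlap event, planting `K_A` is injective in the background. [folklore] -/
theorem l23_eq_of_plantClique_eq (A : Finset (Fin n)) {x x' : Edge n → Bool}
    (hx : ∀ e, cliqueVec A e = true → x e = false) (hx' : ∀ e, cliqueVec A e = true → x' e = false)
    (h : plantClique A x = plantClique A x') : x = x' := by
  funext e
  have he := congrFun h e
  simp only [plantClique] at he
  cases hA : cliqueVec A e with
  | true => rw [hx e hA, hx' e hA]
  | false => simpa [hA] using he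

/-- A planted `k`-clique is a `k`-clique: `CLIQUE_k(x ∪ K_A) = 1` for `|A| = k`. [folklore] -/
theorem l23_cliqueFn_plantClique {k : ℕ} {A : Finset (Fin n)}
    (hA : A ∈ powersetCard k (univ : Finset (Fin n))) (x : Edge n → Bool) :
    cliqueFn n k (plantClique A x) = true :=
  (cliqueCount_ne_zero_iff _).1 (Rossman2010L23.cliqueCount_plantClique_ne_zero hA x)

/-! ## §3 Overlap pairs are rare -/

/-- **Overlap is rare.** The pairs `(x, A) ∈ slice_i × ([n] choose k)` with `K_A ∩ x ≠ ∅` number at most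
`C(n,k) · C(k,2) · (i / C(n,2)) · #slice_i` (union bound over the `C(k,2)` edges of `K_A`, each on with
probability `≤ i / C(n,2)` on the slice). [folklore] -/
theorem l23_card_overlap_le (k : ℕ) {i : ℕ} (hi : i ≤ n.choose 2) (hN : 0 < n.choose 2) :
    (#(((slice n i) ×ˢ powersetCard k (univ : Finset (Fin n))).filter
        fun xa => ∃ e, cliqueVec xa.2 e = true ∧ xa.1 e = true) : ℝ) ≤
      n.choose k * (k.choose 2 * ((i : ℝ) / n.choose 2 * #(slice n i))) := by
  set S := slice n i with hS
  set 𝒜 := powersetCard k (univ : Finset (Fin n)) with h𝒜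
  have h1 : #((S ×ˢ 𝒜).filter fun xa => ∃ e, cliqueVec xa.2 e = true ∧ xa.1 e = true) ≤
      ∑ A ∈ 𝒜, ∑ e ∈ univ.filter (fun e => cliqueVec A e = true), #(S.filter fun x => x e = true) := by
    calc #((S ×ˢ 𝒜).filter fun xa => ∃ e, cliqueVec xa.2 e = true ∧ xa.1 e = true)
        = ∑ A ∈ 𝒜, #(S.filter fun x => ∃ e, cliqueVec A e = true ∧ x e = true) := by
          rw [card_filter, sum_product_right]
          refine sum_congr rfl fun A _ => ?_
          rw [card_filter]
      _ ≤ ∑ A ∈ 𝒜, ∑ e ∈ univ.filter (fun e => cliqueVec A e = true),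
            #(S.filter fun x => x e = true) := by
          refine sum_le_sum fun A _ => ?_
          calc #(S.filter fun x => ∃ e, cliqueVec A e = true ∧ x e = true)
              ≤ #((univ.filter fun e => cliqueVec A e = true).biUnion
                  fun e => S.filter fun x => x e = true) := by
                refine card_le_card fun x hx => ?_
                rw [mem_filter] at hx
                obtain ⟨hxS, e, he, hxe⟩ := hx
                exact mem_biUnion.2 ⟨e, mem_filter.2 ⟨mem_univ _, he⟩, mem_filter.2 ⟨hxS, hxe⟩⟩
            _ ≤ _ := card_biUnion_le
  have h2 : ∀ e : Edge n, (#(S.filter fun x => x e = true) : ℝ) ≤ (i : ℝ) / n.choose 2 * #S := by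
    intro e
    have h := l23_card_slice_filter_supset_le_real ({e} : Finset (Edge n)) hi hN
    rw [card_singleton, pow_one] at h
    have heq : (S.filter fun x => ∀ e' ∈ ({e} : Finset (Edge n)), x e' = true) =
        S.filter fun x => x e = true :=
      filter_congr fun x _ => by simp
    rwa [heq] at h
  have h1' : (#((S ×ˢ 𝒜).filter fun xa => ∃ e, cliqueVec xa.2 e = true ∧ xa.1 e = true) : ℝ) ≤
      ∑ A ∈ 𝒜, ∑ e ∈ univ.filter (fun e => cliqueVec A e = true),
        (#(S.filter fun x => x e = true) : ℝ) := by
    exact_mod_cast h1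
  calc (#((S ×ˢ 𝒜).filter fun xa => ∃ e, cliqueVec xa.2 e = true ∧ xa.1 e = true) : ℝ)
      ≤ ∑ A ∈ 𝒜, ∑ e ∈ univ.filter (fun e => cliqueVec A e = true),
          (#(S.filter fun x => x e = true) : ℝ) := h1'
    _ ≤ ∑ A ∈ 𝒜, ∑ _e ∈ univ.filter (fun e => cliqueVec A e = true), (i : ℝ) / n.choose 2 * #S :=
        sum_le_sum fun A _ => sum_le_sum fun e _ => h2 e
    _ = ∑ A ∈ 𝒜, (k.choose 2 : ℝ) * ((i : ℝ) / n.choose 2 * #S) := by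
        refine sum_congr rfl fun A hA => ?_
        rw [sum_const, card_filter_cliqueVec, (mem_powersetCard.1 hA).2, nsmul_eq_mul]
    _ = n.choose k * (k.choose 2 * ((i : ℝ) / n.choose 2 * #S)) := by
        rw [sum_const, card_powersetCard, card_univ, Fintype.card_fin, nsmul_eq_mul]

/-- **Registered sub-goal of this helper file** (`∀`-form of `l23_card_overlap_le`, stub `l23_overlap_pkg` on
stmt-PneNP-2834): the overlap pairs are a `≤ C(k,2)·i/C(n,2)` fraction of `slice_i × ([n] choose k)`.
[folklore] -/
theorem l23_overlap_pkg : ∀ n k i : ℕ, i ≤ n.choose 2 → 0 < n.choose 2 →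
    (#(((slice n i) ×ˢ powersetCard k (univ : Finset (Fin n))).filter
        fun xa => ∃ e, cliqueVec xa.2 e = true ∧ xa.1 e = true) : ℝ) ≤
      n.choose k * (k.choose 2 * ((i : ℝ) / n.choose 2 * #(slice n i))) :=
  fun _ k _ hi hN => l23_card_overlap_le k hi hN

/-! ## §4 Non-overlap planted pairs fibre over the planted vector -/

/-- **Fibres of planting.** Off the overlap event the map `(x, A) ↦ (x ∪ K_A, A)` is injective, lands in
the slice `i + C(k,2)`, keeps `f(x ∪ K_A) = 0` and produces a `k`-clique; so the non-overlap pairs with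
`f(x ∪ K_A) = 0` number at most `Σ_{y ∈ Q} ω_k(y)` for any `Q` containing the vectors `y` of the slice
`i + C(k,2)` with `f(y) = 0` and `CLIQUE_k(y) = 1` (`ω_k(y) = #{A : K_A ⊆ y}`). [folklore] -/
theorem l23_card_noOverlap_le (k i : ℕ) (f : (Edge n → Bool) → Bool) {Q : Finset (Edge n → Bool)}
    (hQ : ∀ y ∈ slice n (i + k.choose 2), f y = false → cliqueFn n k y = true → y ∈ Q) :
    #(((slice n i) ×ˢ powersetCard k (univ : Finset (Fin n))).filter fun xa =>
        f (plantClique xa.2 xa.1) = false ∧ ∀ e, cliqueVec xa.2 e = true → xa.1 e = false) ≤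
      ∑ y ∈ Q, #((powersetCard k (univ : Finset (Fin n))).filter
        fun A => ∀ e, cliqueVec A e = true → y e = true) := by
  set S := slice n i with hS
  set 𝒜 := powersetCard k (univ : Finset (Fin n)) with h𝒜
  set W := (Q ×ˢ 𝒜).filter fun yA => ∀ e, cliqueVec yA.2 e = true → yA.1 e = true with hW
  have hcW : #W = ∑ y ∈ Q, #(𝒜.filter fun A => ∀ e, cliqueVec A e = true → y e = true) := by
    rw [hW, card_filter, sum_product]
    refine sum_congr rfl fun y _ => ?_
    rw [card_filter]
  rw [← hcW]
  refine card_le_card_of_injOn (fun xa => (plantClique xa.2 xa.1, xa.2)) (fun xa hxa => ?_)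
    (fun xa hxa xa' hxa' h => ?_)
  · rw [mem_coe, mem_filter, mem_product] at hxa
    obtain ⟨⟨hxS, hA⟩, hf, hno⟩ := hxa
    rw [mem_coe, hW, mem_filter, mem_product]
    refine ⟨⟨hQ _ ?_ hf (l23_cliqueFn_plantClique hA _), hA⟩, Rossman2010L23.sub_plantClique _ _⟩
    rw [hS, slice, mem_filter] at hxS
    rw [slice, mem_filter]
    refine ⟨mem_univ _, ?_⟩
    rw [l23_edgeCount_plantClique _ hno, hxS.2, (mem_powersetCard.1 hA).2]
  · obtain ⟨x, A⟩ := xa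
    obtain ⟨x', A'⟩ := xa'
    simp only [Prod.mk.injEq] at h
    obtain ⟨h1, h2⟩ := h
    subst h2
    rw [mem_coe, mem_filter] at hxa hxa'
    simp only [Prod.mk.injEq, and_true]
    exact l23_eq_of_plantClique_eq A hxa.2.2 hxa'.2.2 h1

/-! ## §5 Adjacent slice sizes -/

/-- `C(N, i+K) · (i+1)^K ≤ C(N, i) · N^K`: from `C(N,i+K)·C(i+K,i) = C(N,i)·C(N-i,K)`,
`(i+1)^K ≤ K!·C(i+K,K)` and `K!·C(N-i,K) ≤ (N-i)^K ≤ N^K`. [folklore] -/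
theorem l23_choose_add_mul_pow_le (N i K : ℕ) :
    N.choose (i + K) * (i + 1) ^ K ≤ N.choose i * N ^ K := by
  have h1 : (i + 1) ^ K ≤ (i + K).descFactorial K := by
    have := Nat.pow_sub_le_descFactorial (i + K) K
    rwa [show i + K + 1 - K = i + 1 by omega] at this
  have h2 : (i + K).descFactorial K = K.factorial * (i + K).choose K :=
    Nat.descFactorial_eq_factorial_mul_choose _ _
  have h3 : N.choose (i + K) * (i + K).choose i = N.choose i * (N - i).choose K := by
    have := Nat.choose_mul (n := N) (k := i + K) (s := i) (Nat.le_add_right i K)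
    rwa [Nat.add_sub_cancel_left] at this
  have h4 : (i + K).choose i = (i + K).choose K := Nat.choose_symm_add
  have h5 : K.factorial * (N - i).choose K = (N - i).descFactorial K :=
    (Nat.descFactorial_eq_factorial_mul_choose _ _).symm
  have h6 : (N - i).descFactorial K ≤ N ^ K :=
    (Nat.descFactorial_le_pow _ _).trans (Nat.pow_le_pow_left (Nat.sub_le N i) K)
  calc N.choose (i + K) * (i + 1) ^ K ≤ N.choose (i + K) * (K.factorial * (i + K).choose K) := by
        rw [← h2]; exact Nat.mul_le_mul_left _ h1
    _ = K.factorial * (N.choose (i + K) * (i + K).choose i) := by rw [h4]; ring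
    _ = K.factorial * (N.choose i * (N - i).choose K) := by rw [h3]
    _ = N.choose i * (K.factorial * (N - i).choose K) := by ring
    _ ≤ N.choose i * N ^ K := by rw [h5]; exact Nat.mul_le_mul_left _ h6

/-! ## §6 Window asymptotics: a central band sits inside `[T/2, 2T - C(k,2)]` eventually

Here `θ = n^{-2/(k-1)}` and `T = C(n,2)·θ` (so `thr k n = ⌊T⌋₊`) are written out; no new definitions. -/

open scoped Topology in
/-- **The eventual regime.** For `k ≥ 3`, a width `w` and `ε > 0`, eventually in `n`: `n ≥ 2k`,
`T^{3/4} ≤ T/4`, `T ≥ 4(w + C(k,2) + 1)`, `θ ≤ 1/2` and `2·C(k,2)·θ ≤ ε`. [folklore] -/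
theorem l23_eventually_regime {k : ℕ} (hk : 3 ≤ k) (w : ℕ) {ε : ℝ} (hε : 0 < ε) :
    ∀ᶠ n : ℕ in atTop, 2 * k ≤ n ∧
      ((n.choose 2 : ℝ) * (n : ℝ) ^ (-(2 : ℝ) / ((k : ℝ) - 1))) ^ ((3 : ℝ) / 4) ≤
          (n.choose 2 : ℝ) * (n : ℝ) ^ (-(2 : ℝ) / ((k : ℝ) - 1)) / 4 ∧
      4 * ((w : ℝ) + k.choose 2 + 1) ≤ (n.choose 2 : ℝ) * (n : ℝ) ^ (-(2 : ℝ) / ((k : ℝ) - 1)) ∧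
      (n : ℝ) ^ (-(2 : ℝ) / ((k : ℝ) - 1)) ≤ 1 / 2 ∧
      2 * (k.choose 2 : ℝ) * (n : ℝ) ^ (-(2 : ℝ) / ((k : ℝ) - 1)) ≤ ε := by
  -- `T_k(n) = C(n,2)·n^{-2/(k-1)} ≥ (n-1)/2 → ∞` (cf. `Cruxes/ConstantBand/Disproof.lean` §4 `T_ge`, `tendsto_T`)
  have hT : Tendsto (fun n : ℕ => (n.choose 2 : ℝ) * (n : ℝ) ^ (-(2 : ℝ) / ((k : ℝ) - 1))) atTop atTop := by
    have h1 : Tendsto (fun n : ℕ => ((n : ℝ) - 1) / 2) atTop atTop := by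
      refine Tendsto.atTop_div_const (by norm_num) ?_
      simpa [sub_eq_add_neg] using
        tendsto_atTop_add_const_right atTop (-1 : ℝ) tendsto_natCast_atTop_atTop
    refine tendsto_atTop_mono' atTop ?_ h1
    filter_upwards [eventually_ge_atTop 1] with n hn
    have hn1 : (1 : ℝ) ≤ n := by exact_mod_cast hn
    have hk' : (3 : ℝ) ≤ k := by exact_mod_cast hk
    have hθ' : (n : ℝ) ^ (-(1 : ℝ)) ≤ (n : ℝ) ^ (-(2 : ℝ) / ((k : ℝ) - 1)) := by
      apply Real.rpow_le_rpow_of_exponent_le hn1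
      rw [neg_div, neg_le_neg_iff, div_le_one (by linarith)]
      linarith
    calc ((n : ℝ) - 1) / 2 = (n.choose 2 : ℝ) * (n : ℝ) ^ (-(1 : ℝ)) := by
          rw [Nat.cast_choose_two, Real.rpow_neg_one]
          field_simp
      _ ≤ _ := mul_le_mul_of_nonneg_left hθ' (Nat.cast_nonneg _)
  have hθ : Tendsto (fun n : ℕ => (n : ℝ) ^ (-(2 : ℝ) / ((k : ℝ) - 1))) atTop (𝓝 0) :=
    tendsto_rpow_threshold (k := k) (by omega)
  have hK0 : (0 : ℝ) < 2 * (k.choose 2 : ℝ) := by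
    have : 0 < k.choose 2 := Nat.choose_pos (by omega)
    positivity
  have hθε : Tendsto (fun n : ℕ => 2 * (k.choose 2 : ℝ) * (n : ℝ) ^ (-(2 : ℝ) / ((k : ℝ) - 1)))
      atTop (𝓝 0) := by
    simpa using hθ.const_mul (2 * (k.choose 2 : ℝ))
  have h14 : Tendsto (fun n : ℕ =>
      ((n.choose 2 : ℝ) * (n : ℝ) ^ (-(2 : ℝ) / ((k : ℝ) - 1))) ^ (-(1 / 4 : ℝ))) atTop (𝓝 0) :=
    (tendsto_rpow_neg_atTop (by norm_num : (0 : ℝ) < 1 / 4)).comp hT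
  filter_upwards [eventually_ge_atTop (2 * k), h14.eventually_le_const (by norm_num : (0 : ℝ) < 1 / 4),
    hT.eventually_gt_atTop 0, hT.eventually_ge_atTop (4 * ((w : ℝ) + k.choose 2 + 1)),
    hθ.eventually_le_const (by norm_num : (0 : ℝ) < 1 / 2), hθε.eventually_le_const hε]
    with n h2k hle hpos hTw hhalf hεn
  refine ⟨h2k, ?_, hTw, hhalf, hεn⟩
  set T := (n.choose 2 : ℝ) * (n : ℝ) ^ (-(2 : ℝ) / ((k : ℝ) - 1)) with hTdef
  have h34 : T ^ ((3 : ℝ) / 4) = T * T ^ (-(1 / 4 : ℝ)) := by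
    rw [show (3 : ℝ) / 4 = 1 + -(1 / 4) by norm_num, Real.rpow_add hpos, Real.rpow_one]
  rw [h34]
  calc T * T ^ (-(1 / 4 : ℝ)) ≤ T * (1 / 4) := mul_le_mul_of_nonneg_left hle hpos.le
    _ = T / 4 := by ring

/-- **Window bookkeeping.** With `T = C(n,2)·n^{-2/(k-1)}` (so `thr k n = ⌊T⌋₊`): if `T^{3/4} ≤ T/4` and
`4(w + K + 1) ≤ T`, then for central `j` and `j - w ≤ i ≤ j + w` one has `T/2 ≤ i` and `i + K ≤ 2T`.
[folklore] -/
theorem l23_window {k n j i w K : ℕ} {T : ℝ}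
    (hT : T = (n.choose 2 : ℝ) * (n : ℝ) ^ (-(2 : ℝ) / ((k : ℝ) - 1)))
    (h34 : T ^ ((3 : ℝ) / 4) ≤ T / 4) (hTw : 4 * ((w : ℝ) + K + 1) ≤ T)
    (hj : Central k n j) (h1 : j ≤ i + w) (h2 : i ≤ j + w) :
    T / 2 ≤ i ∧ (i : ℝ) + K ≤ 2 * T := by
  have hT0 : 0 ≤ T := by
    rw [hT]; exact mul_nonneg (Nat.cast_nonneg _) (Real.rpow_nonneg (Nat.cast_nonneg _) _)
  have hthr : thr k n = ⌊T⌋₊ := by rw [hT]; rfl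
  have hfl : (thr k n : ℝ) ≤ T := by rw [hthr]; exact Nat.floor_le hT0
  have hlt : T < thr k n + 1 := by rw [hthr]; exact Nat.lt_floor_add_one T
  have hrp : (thr k n : ℝ) ^ ((3 : ℝ) / 4) ≤ T ^ ((3 : ℝ) / 4) :=
    Real.rpow_le_rpow (Nat.cast_nonneg _) hfl (by norm_num)
  obtain ⟨hju, hjl⟩ := abs_sub_le_iff.1 hj
  have h1' : (j : ℝ) ≤ i + w := by exact_mod_cast h1
  have h2' : (i : ℝ) ≤ j + w := by exact_mod_cast h2
  have hK0 : (0 : ℝ) ≤ K := Nat.cast_nonneg K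
  have hw0 : (0 : ℝ) ≤ w := Nat.cast_nonneg w
  constructor
  · linarith
  · linarith

/-- **The regime, unpacked on a band slice.** In the eventual regime of `l23_eventually_regime`, for central
`j` and `j - w ≤ i ≤ j + w`: `C(k,2) ≤ i`, `i + C(k,2) ≤ C(n,2)`, `(i + C(k,2))/C(n,2) ≤ 2θ`,
`θ/2 ≤ i/C(n,2)` and `C(k,2)·i ≤ ε·C(n,2)`. [folklore] -/
theorem l23_regime_slice {k n j i w : ℕ} {ε : ℝ}
    (h34 : ((n.choose 2 : ℝ) * (n : ℝ) ^ (-(2 : ℝ) / ((k : ℝ) - 1))) ^ ((3 : ℝ) / 4) ≤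
      (n.choose 2 : ℝ) * (n : ℝ) ^ (-(2 : ℝ) / ((k : ℝ) - 1)) / 4)
    (hTw : 4 * ((w : ℝ) + k.choose 2 + 1) ≤ (n.choose 2 : ℝ) * (n : ℝ) ^ (-(2 : ℝ) / ((k : ℝ) - 1)))
    (hhalf : (n : ℝ) ^ (-(2 : ℝ) / ((k : ℝ) - 1)) ≤ 1 / 2)
    (hε : 2 * (k.choose 2 : ℝ) * (n : ℝ) ^ (-(2 : ℝ) / ((k : ℝ) - 1)) ≤ ε)
    (hN : 0 < n.choose 2) (hj : Central k n j) (h1 : j ≤ i + w) (h2 : i ≤ j + w) :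
    k.choose 2 ≤ i ∧ i + k.choose 2 ≤ n.choose 2 ∧
      ((i + k.choose 2 : ℕ) : ℝ) / n.choose 2 ≤ 2 * (n : ℝ) ^ (-(2 : ℝ) / ((k : ℝ) - 1)) ∧
      (n : ℝ) ^ (-(2 : ℝ) / ((k : ℝ) - 1)) / 2 ≤ (i : ℝ) / n.choose 2 ∧
      (k.choose 2 : ℝ) * i ≤ ε * n.choose 2 := by
  set θ := (n : ℝ) ^ (-(2 : ℝ) / ((k : ℝ) - 1)) with hθ
  set T := (n.choose 2 : ℝ) * θ with hT
  obtain ⟨hlo, hhi⟩ := l23_window (K := k.choose 2) hT h34 hTw hj h1 h2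
  have hN' : (0 : ℝ) < n.choose 2 := by exact_mod_cast hN
  have hθ0 : 0 ≤ θ := Real.rpow_nonneg (Nat.cast_nonneg _) _
  have hK0 : (0 : ℝ) ≤ k.choose 2 := Nat.cast_nonneg _
  have hi0 : (0 : ℝ) ≤ i := Nat.cast_nonneg _
  refine ⟨?_, ?_, ?_, ?_, ?_⟩
  · have : (k.choose 2 : ℝ) ≤ i := by linarith
    exact_mod_cast this
  · have h2T : 2 * T ≤ n.choose 2 := by
      rw [hT]
      calc 2 * ((n.choose 2 : ℝ) * θ) = (n.choose 2 : ℝ) * (2 * θ) := by ring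
        _ ≤ (n.choose 2 : ℝ) * 1 := mul_le_mul_of_nonneg_left (by linarith) hN'.le
        _ = n.choose 2 := mul_one _
    have : ((i + k.choose 2 : ℕ) : ℝ) ≤ n.choose 2 := by push_cast; linarith
    exact_mod_cast this
  · rw [div_le_iff₀ hN']
    push_cast
    calc (i : ℝ) + k.choose 2 ≤ 2 * T := hhi
      _ = 2 * θ * n.choose 2 := by rw [hT]; ring
  · rw [le_div_iff₀ hN']
    calc θ / 2 * n.choose 2 = T / 2 := by rw [hT]; ring
      _ ≤ i := hlo
  · have hi2T : (i : ℝ) ≤ 2 * T := by linarith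
    calc (k.choose 2 : ℝ) * i ≤ k.choose 2 * (2 * T) := mul_le_mul_of_nonneg_left hi2T hK0
      _ = (2 * (k.choose 2 : ℝ) * θ) * n.choose 2 := by rw [hT]; ring
      _ ≤ ε * n.choose 2 := mul_le_mul_of_nonneg_right hε hN'.le

end Summit.PneNP.PneNP.Cruxes.ConstantBand.FlatPriorRelativeMinterms

end
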